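import Mathlib.Topology.Algebra.OpenSubgroup
import Mathlib.GroupTheory.Index
import Mathlib.GroupTheory.QuotientGroup.Defs
import Mathlib.Data.Set.Countable
import Mathlib.Data.Fintype.Powerset
import Literature.AnabelianGeometry.SemiGraphs.TemperedAnabelian
import HarnessLib

/-!
# Cofinality of open normal finite-index subgroups: a COUNTABILITY OBSTRUCTION
# (classical lemmas next to the interface `IsProfiniteCompletion` of [SemiAnbd] §6)

Mochizuki, *Semi-graphs of anabelioids*, Publ. RIMS **42** (2006) [SemiAnbd], §6 p. 69 ("we shall denote
the profinite completion of a group by means of a `∧`") and p. 73 ("the `∧` denotes profinite completion, or,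
equivalently, closure in `Π_{X_K}`, `Π_{Y_L}`") [cite: MochizukiSemiAnbd2006, §6 p.69, p.73];
Mochizuki, *The étale theta function …*, Publ. RIMS **45** (2009) [EtTh], Remark 1.6.4 p. 252 ("the set of
classes … determines, by profinite completion, a set of classes … `∈ H¹(Π_{Ÿ^∧}, Δ_Θ)`")
[cite: MochizukiEtTh2009, Rmk 1.6.4 p.252].

PROOF-ONLY companion (abc-iut cell, prover abc-iut-f-127 gen 8; INPUT to the L2 VNEXT row
«RMK164-PROFINITE-TWIN», sizing memo abc-iut-f-128 gen 7) of `TemperedAnabelian.lean`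
(`IsProfiniteCompletion`, abc-iut-L3-t2).  No definition, no named fact, no instance.

THE QUESTION.  For a profinite completion `ι : F → F̂` and a subgroup `U ≤ F` of INFINITE index (the case
`U = Π^tp_Ÿ ≤ F = Π^tp_X` of [EtTh] §1: `Π^tp_X/Π^tp_Y ≅ ℤ`), "the closure of `ι(U)` in `F̂` is the
profinite completion of `U`" is NOT formal; the planned route (memo §D3) assumes the cofinality hypothesis

  `h_cof` : every open normal subgroup `U′ ≤ U` of finite index contains `U ⊓ V` for some open normal
            subgroup `V ≤ F` of finite index.

THIS FILE records the elementary obstruction to `h_cof`: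

* `finite_openNormalSubgroup_le` — only finitely many open normal subgroups of a topological group contain
  a given subgroup of finite index;
* `countable_openNormalSubgroup_finiteIndex_of_cofinal` — under `h_cof`, if `F` has countably many open
  normal finite-index subgroups then so does `U`;
* `not_cofinal_of_countable_of_not_countable` — contrapositive: countably many for `F`, uncountably many for
  `U` ⟹ `h_cof` fails;
* `IsProfiniteCompletion.countable_openNormalSubgroup_finiteIndex` — if `F̂` has countably many open normal
  subgroups (e.g. `F̂` topologically finitely generated), then `F` has countably many open normal
  finite-index subgroups (they are the `ι`-preimages, `IsProfiniteCompletion.comap_surjective`);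
* `IsProfiniteCompletion.not_cofinal_of_not_countable` — the two combined.

HONEST FRAMING: classical topological group theory; nothing of [SemiAnbd]/[EtTh] is asserted.  The intended
reading (a FINDING for the planning of Rmk 1.6.4, not a kernel statement about André's groups, which the
tree only carries as the interface `TemperedCurve`): for the genuine tempered fundamental group of a curve of
type `(1,1)` the subgroup `Π^tp_Ÿ` has uncountably many open normal finite-index subgroups as soon as some
finite étale Galois covering `X′ → X` has a special-fibre dual graph with first Betti number `≥ 2` (then
`Gal(X′^∞/Ÿ·X′)` is a free group of infinite rank, normal of finite index in the discrete quotient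
`Gal(X′^∞/Ÿ)` of `Π^tp_Ÿ`), whereas `Π_X` is topologically finitely generated; so `h_cof` is a hypothesis
that the cell's PROFINITE models satisfy and the genuine object is not expected to, and print's "determines,
by profinite completion" is to be read as EXTENSION BY CONTINUITY (for the `Π_X`-induced topology) along the
dense subgroup `ι(Π^tp_Ÿ)` of its closure.  No side is taken on [IUTchIII] Cor. 3.12.

v2 (doc-only, abc-iut-f-127 g8 after aud-9 RQ7 m1): [SemiAnbd] locator of the "closure" parenthetical
corrected to p. 73 (p. 69 carries only the `∧`-convention); declarations byte-identical.
-/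

namespace Literature.AnabelianGeometry.SemiGraphs

open Topology

universe u v

section Finite

variable {U : Type u} [Group U] [TopologicalSpace U]

/-- **Only finitely many open normal subgroups contain a given subgroup of finite index.**  For
`N ≤ U` of finite index, an open normal subgroup `U′ ⊇ N` is the preimage of its image in the finite coset
space `U ⧸ N`, so `U′ ↦ (image of U′ in U ⧸ N)` is injective into the finite type `Set (U ⧸ N)`.
(Classical; no normality of `N` is needed.) [cite: MochizukiSemiAnbd2006, §6 p.69] -/
theorem finite_openNormalSubgroup_le (N : Subgroup U) [N.FiniteIndex] :
    {U' : OpenNormalSubgroup U | N ≤ U'.toSubgroup}.Finite := by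
  -- the preimage of the image recovers an open normal subgroup containing `N`
  have key : ∀ C : OpenNormalSubgroup U, N ≤ C.toSubgroup →
      (QuotientGroup.mk ⁻¹' ((QuotientGroup.mk : U → U ⧸ N) '' (C : Set U)) : Set U) = C := by
    intro C hC
    ext x
    constructor
    · rintro ⟨c, hc, hcx⟩
      have hN : c⁻¹ * x ∈ N := QuotientGroup.eq.mp hcx
      have hx : x = c * (c⁻¹ * x) := by group
      rw [hx]
      exact C.toSubgroup.mul_mem hc (hC hN)
    · intro hx
      exact ⟨x, hx, rfl⟩
  let f : {U' : OpenNormalSubgroup U | N ≤ U'.toSubgroup} → Set (U ⧸ N) :=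
    fun U' => (QuotientGroup.mk : U → U ⧸ N) '' (U'.1 : Set U)
  have hf : Function.Injective f := by
    rintro ⟨A, hA⟩ ⟨B, hB⟩ h
    have h' : (QuotientGroup.mk ⁻¹' ((QuotientGroup.mk : U → U ⧸ N) '' (A : Set U)) : Set U) =
        QuotientGroup.mk ⁻¹' ((QuotientGroup.mk : U → U ⧸ N) '' (B : Set U)) :=
      congrArg (fun S : Set (U ⧸ N) => (QuotientGroup.mk : U → U ⧸ N) ⁻¹' S) h
    rw [key A hA, key B hB] at h'
    exact Subtype.ext (SetLike.coe_injective h')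
  exact Set.finite_coe_iff.mp (Finite.of_injective f hf)

end Finite

section Cofinal

variable {F : Type u} [Group F] [TopologicalSpace F]

/-- **Cofinality forces countability.**  Let `U ≤ F` be a subgroup of a topological group (subspace
topology) satisfying the cofinality hypothesis `h_cof`: every open normal finite-index subgroup `U′` of `U`
contains `U ⊓ V` for some open normal finite-index subgroup `V` of `F`.  If `F` has only countably many open
normal finite-index subgroups, then so has `U`: each `U′` lies in one of the countably many FINITE families
`{U′ ⊇ U ⊓ V}` (`finite_openNormalSubgroup_le`, `[U : U ⊓ V] ≤ [F : V] < ∞`).  (Classical; the hypothesis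
of the planned "closure = completion" lemma for `Π^tp_Ÿ ≤ Π^tp_X`, [EtTh] Rmk 1.6.4.)
[cite: MochizukiEtTh2009, Rmk 1.6.4 p.252] -/
theorem countable_openNormalSubgroup_finiteIndex_of_cofinal (U : Subgroup F)
    (hF : {V : OpenNormalSubgroup F | V.toSubgroup.FiniteIndex}.Countable)
    (hcof : ∀ U' : OpenNormalSubgroup U, U'.toSubgroup.FiniteIndex →
      ∃ V : OpenNormalSubgroup F, V.toSubgroup.FiniteIndex ∧ V.toSubgroup.subgroupOf U ≤ U'.toSubgroup) :
    {U' : OpenNormalSubgroup U | U'.toSubgroup.FiniteIndex}.Countable := by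
  have hsub : {U' : OpenNormalSubgroup U | U'.toSubgroup.FiniteIndex} ⊆
      ⋃ V ∈ {V : OpenNormalSubgroup F | V.toSubgroup.FiniteIndex},
        {U' : OpenNormalSubgroup U | V.toSubgroup.subgroupOf U ≤ U'.toSubgroup} := by
    intro U' hU'
    obtain ⟨V, hV, hle⟩ := hcof U' hU'
    exact Set.mem_biUnion hV hle
  refine Set.Countable.mono hsub (Set.Countable.biUnion hF fun V hV => ?_)
  haveI : V.toSubgroup.FiniteIndex := hV
  exact (finite_openNormalSubgroup_le (V.toSubgroup.subgroupOf U)).countable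

/-- **The countability obstruction to cofinality.**  If `F` has countably many open normal finite-index
subgroups but the subgroup `U ≤ F` (subspace topology) has uncountably many, then the cofinality hypothesis
`h_cof` («every open normal finite-index `U′ ≤ U` contains `U ⊓ V` for some open normal finite-index
`V ≤ F`») FAILS.  (Classical; intended reading: `U = Π^tp_Ÿ ≤ F = Π^tp_X` for André's tempered groups,
where a finite étale covering of `X` whose dual graph has two independent cycles produces a free normal
subgroup of infinite rank and finite index in a discrete quotient of `Π^tp_Ÿ` — see the file header.)
[cite: MochizukiEtTh2009, Rmk 1.6.4 p.252] -/
theorem not_cofinal_of_countable_of_not_countable (U : Subgroup F)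
    (hF : {V : OpenNormalSubgroup F | V.toSubgroup.FiniteIndex}.Countable)
    (hU : ¬ {U' : OpenNormalSubgroup U | U'.toSubgroup.FiniteIndex}.Countable) :
    ¬ ∀ U' : OpenNormalSubgroup U, U'.toSubgroup.FiniteIndex →
      ∃ V : OpenNormalSubgroup F, V.toSubgroup.FiniteIndex ∧ V.toSubgroup.subgroupOf U ≤ U'.toSubgroup :=
  fun hcof => hU (countable_openNormalSubgroup_finiteIndex_of_cofinal U hF hcof)

end Cofinal

namespace IsProfiniteCompletion

variable {F : Type u} {Fhat : Type v} [Group F] [TopologicalSpace F] [Group Fhat] [TopologicalSpace Fhat]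
  {ι : F →ₜ* Fhat}

/-- **A profinite completion with countably many open normal subgroups has countably many open normal
finite-index subgroups downstairs**: by `IsProfiniteCompletion.comap_surjective` ([SemiAnbd] §6 p. 69,
"the `∧` denotes profinite completion") every open normal finite-index `V ≤ F` is `ι⁻¹(W)` for an open
normal `W ≤ F̂`, and `V ↦ V.toSubgroup` is injective.  (E.g. `F̂ = Π_X` topologically finitely generated
has countably many open normal subgroups.) [cite: MochizukiSemiAnbd2006, §6 p.69] -/
theorem countable_openNormalSubgroup_finiteIndex (hι : IsProfiniteCompletion ι)
    (hc : Countable (OpenNormalSubgroup Fhat)) :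
    {V : OpenNormalSubgroup F | V.toSubgroup.FiniteIndex}.Countable := by
  haveI := hc
  refine Set.MapsTo.countable_of_injOn (f := fun V : OpenNormalSubgroup F => V.toSubgroup)
    (t := Set.range fun W : OpenNormalSubgroup Fhat => W.toSubgroup.comap ι.toMonoidHom)
    ?_ ?_ (Set.countable_range _)
  · intro V hV
    obtain ⟨W, hW⟩ := hι.comap_surjective V hV
    exact ⟨W, hW.symm⟩
  · intro A _ B _ h
    exact OpenNormalSubgroup.toSubgroup_injective h

/-- **The obstruction at a profinite completion.**  If `ι : F → F̂` is a profinite completion, `F̂` has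
countably many open normal subgroups, and `U ≤ F` has uncountably many open normal finite-index subgroups,
then the cofinality hypothesis `h_cof` for `U ≤ F` fails — so "the closure of `ι(U)` is the profinite
completion of `U`" cannot be obtained on that route, and [EtTh] Rmk 1.6.4's "determines, by profinite
completion" is to be read as extension by continuity along the dense subgroup `ι(U)` of its closure for
classes continuous in the `F̂`-induced topology.  (Classical.) [cite: MochizukiEtTh2009, Rmk 1.6.4 p.252] -/
theorem not_cofinal_of_not_countable (hι : IsProfiniteCompletion ι)
    (hc : Countable (OpenNormalSubgroup Fhat)) (U : Subgroup F)
    (hU : ¬ {U' : OpenNormalSubgroup U | U'.toSubgroup.FiniteIndex}.Countable) :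
    ¬ ∀ U' : OpenNormalSubgroup U, U'.toSubgroup.FiniteIndex →
      ∃ V : OpenNormalSubgroup F, V.toSubgroup.FiniteIndex ∧ V.toSubgroup.subgroupOf U ≤ U'.toSubgroup :=
  not_cofinal_of_countable_of_not_countable U (hι.countable_openNormalSubgroup_finiteIndex hc) hU

end IsProfiniteCompletion

end Literature.AnabelianGeometry.SemiGraphs
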